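import Summits.CriticalPhenomena.PercolationContinuityZ3.Theorems.Transplant.SharpnessGridCrossings
import Summits.CriticalPhenomena.PercolationContinuityZ3.Theorems.Transplant.SharpnessGridCoarseDecay
import HarnessLib

/-!
# Hole-chain estimates for EVERY mesh (sharpness edition of `SharpnessGridCrossings`)

House module of the `TransplantSharpness` programme (sharpness desk; R84-PLAN "sharpness edition", step 2).
`SharpnessGridCrossings.real_compl_holeTB_le / real_compl_holeLR_le` bound the probability of a missing hole-chain crossing by
the Peierls rate `n (4 p^M)^{m+1}`, useful only when `4 p^M < 1`.  Here the same events are bounded for every mesh `M` with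
`p^M < ½` through `SharpnessGridCoarseDecay.real_coarsePathEvent_le_exp` (series law + subcritical sharpness on `ℤ²`):
`P_p(no hole-chain crossing) ≤ n · e^{-c r}` whenever the rectangle is `≥ (2r+1)²` cells long in the crossing direction.
The deterministic halves (`exists_coarsePath_of_not_holeTB/LR`) are reused verbatim.
-/

noncomputable section

namespace Summit.CriticalPhenomena.PercolationContinuityZ3.Theorems.TransplantSharpness

open MeasureTheory Literature.Probability.Percolation Literature.Probability.LatticeModels

/-- The coarse path event is antitone in the required length. [folklore] -/
theorem coarsePathEvent_anti {M n n' : ℕ} (h : n ≤ n') (x : Site 2) : coarsePathEvent M n' x ⊆ coarsePathEvent M n x := by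
  rintro ω ⟨hω, y, W, hW, hlen⟩
  exact ⟨hω, y, W, hW, h.trans hlen⟩

/-- **`P_p(no bottom–top hole-chain crossing of u + [0,m] × [0,n]) ≤ n e^{-c r}`** for every mesh with `p^M < ½`, whenever
`(2r+1)² ≤ m + 1` (`n ≥ 1`; `c = c(p, M) > 0` from subcritical sharpness). [folklore] -/
theorem real_compl_holeTB_le_exp {M : ℕ} (p : unitInterval) (hp : (p : ℝ) ^ M < 1 / 2) :
    ∃ c : ℝ, 0 < c ∧ ∀ (m n : ℕ) (u : Site 2) (r : ℕ), 1 ≤ n → (2 * r + 1) ^ 2 ≤ m + 1 →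
      (bondPercolation (zdGraph 2) p).real (holeTB M u m n)ᶜ ≤ n * Real.exp (-c * r) := by
  classical
  obtain ⟨c, hc, hdecay⟩ := real_coarsePathEvent_le_exp p hp
  refine ⟨c, hc, fun m n u r hn hr => ?_⟩
  set μ := bondPercolation (zdGraph 2) p with hμ
  set I : Finset ℕ := Finset.range n with hI
  set f : ℕ → Site 2 := fun k => ![u 0, u 1 + 1 + k] with hf
  have hsub : (holeTB M u m n)ᶜ ∩ {ω | ω ⊆ (zdGraph 2).edgeSet} ⊆ ⋃ k ∈ I, coarsePathEvent M ((2 * r + 1) ^ 2) (f k) := by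
    rintro ω ⟨hω, hωE⟩
    obtain ⟨y, hy0, hy1, hy2, hyev⟩ := exists_coarsePath_of_not_holeTB hωE hn hω
    simp only [Set.mem_iUnion, exists_prop]
    refine ⟨(y 1 - u 1 - 1).toNat, by rw [hI, Finset.mem_range]; omega, ?_⟩
    have : f ((y 1 - u 1 - 1).toNat) = y := by
      ext i; fin_cases i
      · simp [hf, hy0]
      · simp [hf]; omega
    rw [this]
    exact coarsePathEvent_anti hr y hyev
  calc μ.real (holeTB M u m n)ᶜ
      = μ.real ((holeTB M u m n)ᶜ ∩ {ω | ω ⊆ (zdGraph 2).edgeSet}) := measureReal_eq_inter_edgeSet p _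
    _ ≤ μ.real (⋃ k ∈ I, coarsePathEvent M ((2 * r + 1) ^ 2) (f k)) := measureReal_mono hsub (measure_ne_top _ _)
    _ ≤ ∑ k ∈ I, μ.real (coarsePathEvent M ((2 * r + 1) ^ 2) (f k)) := measureReal_biUnion_finset_le I _
    _ ≤ ∑ k ∈ I, Real.exp (-c * r) := Finset.sum_le_sum fun k _ => hdecay r (f k)
    _ = n * Real.exp (-c * r) := by rw [Finset.sum_const, hI, Finset.card_range, nsmul_eq_mul]

/-- **`P_p(no left–right hole-chain crossing of u + [0,m] × [0,n]) ≤ m e^{-c r}`** for every mesh with `p^M < ½`, whenever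
`(2r+1)² ≤ n + 1`. [folklore] -/
theorem real_compl_holeLR_le_exp {M : ℕ} (p : unitInterval) (hp : (p : ℝ) ^ M < 1 / 2) :
    ∃ c : ℝ, 0 < c ∧ ∀ (m n : ℕ) (u : Site 2) (r : ℕ), (2 * r + 1) ^ 2 ≤ n + 1 →
      (bondPercolation (zdGraph 2) p).real (holeLR M u m n)ᶜ ≤ m * Real.exp (-c * r) := by
  classical
  obtain ⟨c, hc, hdecay⟩ := real_coarsePathEvent_le_exp p hp
  refine ⟨c, hc, fun m n u r hr => ?_⟩
  set μ := bondPercolation (zdGraph 2) p with hμ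
  set I : Finset ℕ := Finset.range m with hI
  set f : ℕ → Site 2 := fun k => ![u 0 + 1 + k, u 1 + n + 1] with hf
  have hsub : (holeLR M u m n)ᶜ ∩ {ω | ω ⊆ (zdGraph 2).edgeSet} ⊆ ⋃ k ∈ I, coarsePathEvent M ((2 * r + 1) ^ 2) (f k) := by
    rintro ω ⟨hω, hωE⟩
    obtain ⟨y, hy0, hy1, hy2, hyev⟩ := exists_coarsePath_of_not_holeLR hωE hω
    simp only [Set.mem_iUnion, exists_prop]
    refine ⟨(y 0 - u 0 - 1).toNat, by rw [hI, Finset.mem_range]; omega, ?_⟩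
    have : f ((y 0 - u 0 - 1).toNat) = y := by
      ext i; fin_cases i
      · simp [hf]; omega
      · simp [hf, hy2]
    rw [this]
    exact coarsePathEvent_anti hr y hyev
  calc μ.real (holeLR M u m n)ᶜ
      = μ.real ((holeLR M u m n)ᶜ ∩ {ω | ω ⊆ (zdGraph 2).edgeSet}) := measureReal_eq_inter_edgeSet p _
    _ ≤ μ.real (⋃ k ∈ I, coarsePathEvent M ((2 * r + 1) ^ 2) (f k)) := measureReal_mono hsub (measure_ne_top _ _)
    _ ≤ ∑ k ∈ I, μ.real (coarsePathEvent M ((2 * r + 1) ^ 2) (f k)) := measureReal_biUnion_finset_le I _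
    _ ≤ ∑ k ∈ I, Real.exp (-c * r) := Finset.sum_le_sum fun k _ => hdecay r (f k)
    _ = m * Real.exp (-c * r) := by rw [Finset.sum_const, hI, Finset.card_range, nsmul_eq_mul]

/-- **Both hole estimates with one constant** (convenience form for the block estimates). [folklore] -/
theorem hole_estimates_exp {M : ℕ} (p : unitInterval) (hp : (p : ℝ) ^ M < 1 / 2) :
    ∃ c : ℝ, 0 < c ∧
      (∀ (m n : ℕ) (u : Site 2) (r : ℕ), 1 ≤ n → (2 * r + 1) ^ 2 ≤ m + 1 →
        (bondPercolation (zdGraph 2) p).real (holeTB M u m n)ᶜ ≤ n * Real.exp (-c * r)) ∧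
      (∀ (m n : ℕ) (u : Site 2) (r : ℕ), (2 * r + 1) ^ 2 ≤ n + 1 →
        (bondPercolation (zdGraph 2) p).real (holeLR M u m n)ᶜ ≤ m * Real.exp (-c * r)) := by
  obtain ⟨c₁, hc₁, h₁⟩ := real_compl_holeTB_le_exp p hp
  obtain ⟨c₂, hc₂, h₂⟩ := real_compl_holeLR_le_exp p hp
  refine ⟨min c₁ c₂, lt_min hc₁ hc₂, fun m n u r hn hr => (h₁ m n u r hn hr).trans ?_, fun m n u r hr => (h₂ m n u r hr).trans ?_⟩
  · exact mul_le_mul_of_nonneg_left (Real.exp_le_exp.2 (by nlinarith [min_le_left c₁ c₂, (Nat.cast_nonneg r : (0:ℝ) ≤ r)]))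
      (Nat.cast_nonneg n)
  · exact mul_le_mul_of_nonneg_left (Real.exp_le_exp.2 (by nlinarith [min_le_right c₁ c₂, (Nat.cast_nonneg r : (0:ℝ) ≤ r)]))
      (Nat.cast_nonneg m)

end Summit.CriticalPhenomena.PercolationContinuityZ3.Theorems.TransplantSharpness
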